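/-
Copyright (c) 2026 the pub-hodgecm-mathlib formalisation cell (harness21).  Prover seat hodgecm-mathlib-K2Liu-p08 (g2), Track B «K2-LIT»,
#184♮ = hLiu418 = `stmt-HodgeConjecture-24832`; K2E5-plan (g6) CO-DEAL 2026-09-04T07:39:22Z «§G1 RESIDUAL» = G1-END (LEAD F0P6-plan (g12) 07:37:26Z (a)),
census `K2/K2Liu-p08/g2/CENSUS-G1END-ResidueLieDerivativeStandard.K2Liu-p08-g2.md`.  Fourth of the G1-END files (the END sentence).
-/
import Summits.HodgeConjecture.HodgeConjecture.Theorems.K2LiuEisensteinTermwiseLieDerivative   -- ★ G1 files 1–3: `hasDerivAt_resNorm_orbit_of_termwise`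
import Summits.HodgeConjecture.HodgeConjecture.Theorems.K2LiuFirstTermResidueGenDefs           -- ★ U0: `resGen`, `exists_continuation_resGen`
import Summits.HodgeConjecture.HodgeConjecture.Theorems.K2LiuFlatSectionLieDerivative          -- ★ G2-PS-A: `hasDerivAt_stdExtension_orbit`
import Summits.HodgeConjecture.HodgeConjecture.Theorems.K2LiuSiegelEisensteinMajorantCompact    -- ★ G1-END 1/3: `exists_summable_majorant_archOrbit`
import Summits.HodgeConjecture.HodgeConjecture.Theorems.K2LiuArchOneParameterOrbitHeight        -- ★ `continuous_archOrbit`, `exists_height_bounds_archOrbit`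
import Summits.HodgeConjecture.HodgeConjecture.Theorems.K2LiuSiegelWeilSectionContinuous       -- ★ `continuous_stdExtension`
import Summits.HodgeConjecture.HodgeConjecture.Theorems.K2LiuContinuationPackageAlgebra         -- ★ G1-END: `continuation_add_mul_*`, `resNorm_continuation_add_mul`
import HarnessLib

/-!
# Crux `HLiu418`, Road I v3, organ G1 — THE END SENTENCE: the `t`-derivative of the canonical residue form of a STANDARD family along an
# archimedean one-parameter orbit is the residue form of its Lie derivative,
# `∂_t resGen(stdExt φ)(h·γ_X t) = resGen(stdExt X·φ)(h·γ_X t) + 2(½ − s₀)·resGen(stdExt H_X·φ)(h·γ_X t)` (`= resGen(stdExt X·φ)` at `s₀ = ½`)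

Cell `hodgecm-mathlib`, crux item hLiu418 = `stmt-HodgeConjecture-24832`; co-dealer K2E5-plan (g6) (SIGS-RoadI-v3 §7 G1), LEAD F0P6-plan (g12).
THEOREMS ONLY (no `def`, no instance, no notation, no named-fact hypothesis, no `sorry`); lane `--supports stmt-HodgeConjecture-24832 --as helper`
(count-neutral).  Consumers: Hol-1 (`𝔭⁻ · Res = 0` ⇒ holomorphic type, per real `X`), U5 (`T₁`-equivariance of the residue map).

THE MATHEMATICS.  Fix an Iwasawa datum `𝒦`, `s₀ ∈ ℂ`, `X ∈ 𝔥_∞ = archSkew`, the orbit `γ_X t = archExp … hX t`, and BY VALUE: a continuous section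
`φ ∈ I(s₀, χ)`, its right Lie derivative `Xφ` (`hXφ : ∂_t|₀ φ(h γ_X t) = Xφ h`, continuous), the height log-derivative `H` (`hH : ∂_t|₀ Φ_𝒦(h γ_X t) = Φ_𝒦 h · H h`,
continuous — for STANDARD data both delivered by ★ `K2LiuIwasawaHeightDerivContinuous.exists_heightDeriv_continuous_of_isStd`), and socket #41's FIVE-CLAUSE
bundles `hex`, `hex₁`, `hex₂` for the three standard families `f = stdExt φ`, `f₁ = stdExt Xφ`, `f₂ = stdExt (H·φ)` (★ `K2LiuFlatSectionLieDerivative`: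
`∂_t f_s(h γ_X t) = f₁ + 2(s − s₀) f₂ =: f′`, `exists_standard_lieDeriv_stdExtension`).  Then:
* (★ `K2LiuContinuationPackageAlgebra`, split off this file) PACKAGE ALGEBRA «re-clear and combine with a holomorphic coefficient»: from `(P₁, E₁)`
  for `f₁` and `(P₂, E₂)` for `f₂`, `P′ := P₁ ∪ P₂`, `E′ := (∏_{P₂∖P₁}(s − p))·E₁ + a(s)·(∏_{P₁∖P₂}(s − p))·E₂` satisfies (i)(ii)(iv)(v) for `f′ = f₁ + a·f₂`
  (`continuation_add_mul_*`; a universal height floor `‖x‖ ≥ c₀ > 0` merges the two growth bounds), and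
  `resNorm P′ E′ = resNorm P₁ E₁ + a(½)·resNorm P₂ E₂` (`resNorm_continuation_add_mul`) — at `a(s) = 2(s − ½)` the second residue DIES;
* §1 the inputs of ★ G1 file 3 `hasDerivAt_resNorm_orbit_of_termwise` for `f, f′` along `h₀·γ_X`: `hX` = ★ `hasDerivAt_stdExtension_orbit`; `hsum` = ★ #9;
  `hmaj` = ★ `exists_summable_majorant_archOrbit` for `f₁ s`, `f₂ s` + triangle; `hγc`, `hγ` = ★ `continuous_archOrbit`, ★ `exists_height_bounds_archOrbit`;
* §2 `hasDerivAt_resNorm_stdExtension_orbit` (packages by value, `resNorm` currency), **`hasDerivAt_resGen_stdExtension_orbit`** and **`hasDerivAt_resGen_stdExtension_orbit_half`** (`s₀ = ½`): the END sentence in ★ `resGen` currency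
  (★ `exists_continuation_resGen`, choice-free by ★ U0.2) — EXACTLY, no limit exchange beyond ★ G1 files 1–2.
`K`-finiteness appears nowhere here: it is consumer-side (sig41 ×3 with ★ `isStandardSectionFamily_lieDeriv ∕ _heightDeriv_mul`, ★ `continuous_stdExtension`,
★ `exists_heightDeriv_continuous_of_isStd`).
[MoeglinWaldspurger1995, IV.1.9–IV.1.11; II.1.7] [KudlaRallis1994, §1 Thm. 1.1] [Liu2021, Lem. B.12 pp. 103–104] [Tan1999, §1 p. 166] [BorelJacquet1979, §1.2, §4.1].
HONEST LABEL.  Count-neutral helper; G1 closes no socket by itself; `HC_CM` is proved only modulo the 7 printed citations (2 remaining named inputs: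
hLiu418 = `stmt-HodgeConjecture-24832`, h413 = `stmt-HodgeConjecture-24833`) until rung 0 closes.
-/

set_option autoImplicit false
set_option linter.dupNamespace false -- the mandated namespace repeats `HodgeConjecture.HodgeConjecture`
set_option Elab.async false

noncomputable section

open NumberField NumberField.mixedEmbedding IsDedekindDomain Filter Metric Set Complex
open scoped Topology BigOperators

namespace Summit.HodgeConjecture.HodgeConjecture.Cruxes.HLiu418.K2LiuResidueLieDerivativeStandard

open Literature.NumberTheory.Automorphic Literature.NumberTheory.Automorphic.UnitaryGroup
open Literature.NumberTheory.GaloisRepresentations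
open Literature.NumberTheory.GelbartRogawski1991 Literature.NumberTheory.GelbartRogawski1991.GRConstruction
open Literature.NumberTheory.K2Lit.SiegelDoubled
open Summit.HodgeConjecture.HodgeConjecture.Cruxes.HLiu418.K2LiuFirstTermResidueFormDefs
open Summit.HodgeConjecture.HodgeConjecture.Cruxes.HLiu418.K2LiuFirstTermResidueForm
open Summit.HodgeConjecture.HodgeConjecture.Cruxes.HLiu418.K2LiuFirstTermResidueGenDefs
open Summit.HodgeConjecture.HodgeConjecture.Cruxes.HLiu418.K2LiuEisensteinTermwiseLieDerivative
open Summit.HodgeConjecture.HodgeConjecture.Cruxes.HLiu418.K2LiuSiegelEisensteinDoubledSummable (siegelEisensteinDoubledSummable)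
open Summit.HodgeConjecture.HodgeConjecture.Cruxes.HLiu418.K2LiuSiegelEisensteinMajorantCompact
open Summit.HodgeConjecture.HodgeConjecture.Cruxes.HLiu418.K2LiuArchOneParameterOrbitDefs
open Summit.HodgeConjecture.HodgeConjecture.Cruxes.HLiu418.K2LiuArchOneParameterOrbitHeight
open Summit.HodgeConjecture.HodgeConjecture.Cruxes.HLiu418.K2LiuFlatSectionLieDerivative
open Summit.HodgeConjecture.HodgeConjecture.Cruxes.HLiu418.K2LiuIwasawaDeltaUnimodular (IwasawaDatum.modDelta_eq_one_of_mem)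
open Summit.HodgeConjecture.HodgeConjecture.Cruxes.HLiu418.K2LiuSiegelWeilSectionContinuous (continuous_stdExtension)
open Summit.HodgeConjecture.HodgeConjecture.Cruxes.HLiu418.K2LiuContinuationPackageAlgebra

section Frame

variable (L : Type) [Field L] [NumberField L] [IsCMField L]
variable {N M n : ℕ} (e : Fin N × Fin M ≃ Fin n)
  (dV : Fin N → L) (hdV : ∀ i, IsCMField.complexConj L (dV i) = dV i) (hdV0 : ∀ i, dV i ≠ 0)
  (dW : Fin M → L) (hdW : ∀ i, IsCMField.complexConj L (dW i) = dW i) (hdW0 : ∀ i, dW i ≠ 0)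

/-! ## §1 The inputs of ★ G1 file 3 for a standard family and its Lie derivative along `h₀ · γ_X` -/

section Inputs

variable (𝒦 : IwasawaDatum L e dV hdV dW hdW) (s₀ : ℂ)
variable {X : Matrix (Fin (n + n)) (Fin (n + n)) (mixedSpace L)}
  (hX : X ∈ archSkew (Fp L) L (IsCMField.complexConj L) (n + n) (hermD L e dV hdV dW hdW))

include hdV0 hdW0 in
/-- **the segment-uniform majorant `hmaj` of the derived family `f′ = f₁ + a·f₂`** along `h₀·γ_X`, on `{n/2 < re}` (★ `exists_summable_majorant_archOrbit`
for `f₁ s` and `f₂ s` + triangle with the weight `‖a s‖`). [cite: MoeglinWaldspurger1995, II.1.5, II.1.7] [cite: Garrett2018, §3.10] -/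
theorem hmaj_add_mul {χ : HeckeCharacter L} (hχ : χ.IsUnitary) {f₁ f₂ : ℂ → HA L e dV hdV dW hdW → ℂ} (a : ℂ → ℂ)
    (hf₁ : ∀ s, IsSiegelDeltaSection L e dV hdV dW hdW χ s (f₁ s)) (hf₁c : ∀ s, Continuous (f₁ s))
    (hf₂ : ∀ s, IsSiegelDeltaSection L e dV hdV dW hdW χ s (f₂ s)) (hf₂c : ∀ s, Continuous (f₂ s)) (h₀ : HA L e dV hdV dW hdW) :
    ∀ s : ℂ, (n : ℝ) / 2 < s.re → ∀ R : ℝ, ∃ u : SiegelDeltaQuot L e dV hdV dW hdW → ℝ, Summable u ∧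
      ∀ t : ℝ, |t| < R → ∀ q : SiegelDeltaQuot L e dV hdV dW hdW,
        ‖(fun s h => f₁ s h + a s * f₂ s h) s (((Quotient.out q : ratH L e dV hdV dW hdW) : HA L e dV hdV dW hdW) *
          (h₀ * archExp (Fp L) L (IsCMField.complexConj L) (n + n) (hermD L e dV hdV dW hdW) hX t))‖ ≤ u q := by
  intro s hs R
  obtain ⟨u₁, hu₁, hb₁⟩ := exists_summable_majorant_archOrbit L e dV hdV hdV0 dW hdW hdW0 hχ hs (hf₁ s) (hf₁c s) h₀ hX R
  obtain ⟨u₂, hu₂, hb₂⟩ := exists_summable_majorant_archOrbit L e dV hdV hdV0 dW hdW hdW0 hχ hs (hf₂ s) (hf₂c s) h₀ hX R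
  refine ⟨fun q => u₁ q + ‖a s‖ * u₂ q, hu₁.add (hu₂.mul_left _), fun t ht q => ?_⟩
  calc ‖f₁ s _ + a s * f₂ s _‖ ≤ ‖f₁ s _‖ + ‖a s‖ * ‖f₂ s _‖ := by
        refine (norm_add_le _ _).trans ?_
        rw [norm_mul]
    _ ≤ u₁ q + ‖a s‖ * u₂ q := add_le_add (hb₁ t ht q) (mul_le_mul_of_nonneg_left (hb₂ t ht q) (norm_nonneg _))

include hdV0 hdW0 in
/-- **the summability `hsum` of the series of `f s` at the base point of the orbit** on `{n/2 < re}` (★ #9). [cite: Tan1999, §1] [cite: Liu2021, §B.3 p. 101] -/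
theorem hsum_of_section {χ : HeckeCharacter L} (hχ : χ.IsUnitary) {f : ℂ → HA L e dV hdV dW hdW → ℂ}
    (hf : ∀ s, IsSiegelDeltaSection L e dV hdV dW hdW χ s (f s)) (hfc : ∀ s, Continuous (f s)) (x : HA L e dV hdV dW hdW) :
    ∀ s : ℂ, (n : ℝ) / 2 < s.re → Summable fun q : SiegelDeltaQuot L e dV hdV dW hdW =>
      f s (((Quotient.out q : ratH L e dV hdV dW hdW) : HA L e dV hdV dW hdW) * x) :=
  fun s hs => (siegelEisensteinDoubledSummable L e dV hdV hdV0 dW hdW hdW0 χ hχ s hs (f s) (hf s) (hfc s) x).of_norm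

/-- **the section-level derivative `hX` along `h · (h₀ · γ_X t)`** for `f = stdExt φ`, `f′ = stdExt Xφ + 2(s − s₀)·stdExt(H·φ)` (★ `hasDerivAt_stdExtension_orbit`
at the base point `h·h₀`). [cite: KudlaRallis1994, §1] [cite: Tan1999, §1 p. 166] -/
theorem hX_stdExtension {φ Xφ : HA L e dV hdV dW hdW → ℂ} {H : HA L e dV hdV dW hdW → ℝ}
    (hXφ : ∀ h : HA L e dV hdV dW hdW,
      HasDerivAt (fun t : ℝ => φ (h * archExp (Fp L) L (IsCMField.complexConj L) (n + n) (hermD L e dV hdV dW hdW) hX t)) (Xφ h) 0)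
    (hH : ∀ h : HA L e dV hdV dW hdW,
      HasDerivAt (fun t : ℝ => modDelta L e dV hdV dW hdW (𝒦.pPart (h * archExp (Fp L) L (IsCMField.complexConj L) (n + n)
        (hermD L e dV hdV dW hdW) hX t))) (modDelta L e dV hdV dW hdW (𝒦.pPart h) * H h) 0)
    (h₀ : HA L e dV hdV dW hdW) (s : ℂ) (h : HA L e dV hdV dW hdW) (t : ℝ) :
    HasDerivAt (fun t : ℝ => stdExtension 𝒦 s₀ φ s (h * (h₀ * archExp (Fp L) L (IsCMField.complexConj L) (n + n) (hermD L e dV hdV dW hdW) hX t)))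
      ((fun s x => stdExtension 𝒦 s₀ Xφ s x + 2 * (s - s₀) * stdExtension 𝒦 s₀ (fun y => (H y : ℂ) * φ y) s x) s
        (h * (h₀ * archExp (Fp L) L (IsCMField.complexConj L) (n + n) (hermD L e dV hdV dW hdW) hX t))) t := by
  have key := hasDerivAt_stdExtension_orbit 𝒦 s₀ hX hXφ hH s (h * h₀) t
  simp only [← mul_assoc] at key ⊢
  exact key

end Inputs

/-! ## §2 THE END SENTENCE -/

section End

variable (𝒦 : IwasawaDatum L e dV hdV dW hdW) (s₀ : ℂ)
variable {X : Matrix (Fin (n + n)) (Fin (n + n)) (mixedSpace L)}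
  (hX : X ∈ archSkew (Fp L) L (IsCMField.complexConj L) (n + n) (hermD L e dV hdV dW hdW))

include hdV0 hdW0 in
/-- **G1-END IN `resNorm` CURRENCY (packages by value).**  `n ≥ 1`, `χ` unitary, `𝒦` an Iwasawa datum, `s₀ ∈ ℂ`, `X ∈ 𝔥_∞`; a continuous section
`φ ∈ I(s₀, χ)`, `Xφ` (`hXφ`, continuous), `H` (`hH`, continuous); socket #41's clauses BY VALUE: `(P, E⋆)` with (i), (iv) for `stdExt φ`, `(P₁, E₁)` with
(i)(ii)(iv)(v) for `stdExt Xφ`, `(P₂, E₂)` with (i)(ii)(iv)(v) for `stdExt(H·φ)`.  Then along `h₀·γ_X`: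
`HasDerivAt (fun t => resNorm P E⋆ (h₀·γ_X t)) (resNorm P₁ E₁ (h₀·γ_X t) + 2(½ − s₀)·resNorm P₂ E₂ (h₀·γ_X t)) t` (★ G1 file 3 with the combined package
`(P₁ ∪ P₂, E′)` of ★ `K2LiuContinuationPackageAlgebra`). [cite: MoeglinWaldspurger1995, IV.1.9–IV.1.11] [cite: KudlaRallis1994, §1 Thm. 1.1] [cite: Liu2021, Lem. B.12 pp. 103–104] -/
theorem hasDerivAt_resNorm_stdExtension_orbit (hn : 0 < n) {χ : HeckeCharacter L} (hχ : χ.IsUnitary)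
    {φ Xφ : HA L e dV hdV dW hdW → ℂ} {H : HA L e dV hdV dW hdW → ℝ}
    (hφ : IsSiegelDeltaSection L e dV hdV dW hdW χ s₀ φ) (hφc : Continuous φ)
    (hXφ : ∀ h : HA L e dV hdV dW hdW,
      HasDerivAt (fun t : ℝ => φ (h * archExp (Fp L) L (IsCMField.complexConj L) (n + n) (hermD L e dV hdV dW hdW) hX t)) (Xφ h) 0)
    (hXφc : Continuous Xφ)
    (hH : ∀ h : HA L e dV hdV dW hdW,
      HasDerivAt (fun t : ℝ => modDelta L e dV hdV dW hdW (𝒦.pPart (h * archExp (Fp L) L (IsCMField.complexConj L) (n + n)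
        (hermD L e dV hdV dW hdW) hX t))) (modDelta L e dV hdV dW hdW (𝒦.pPart h) * H h) 0)
    (hHc : Continuous H)
    (P : Finset ℂ) (Es : ℂ → HA L e dV hdV dW hdW → ℂ)
    (hd : ∀ h : HA L e dV hdV dW hdW, DifferentiableOn ℂ (fun s => Es s h) {s : ℂ | 0 < s.re})
    (hiv : ∀ (s : ℂ) (h : HA L e dV hdV dW hdW), (n : ℝ) / 2 < s.re →
      Es s h = (∏ p ∈ P, (s - p)) * eisensteinFamilyDelta L e dV hdV dW hdW (stdExtension 𝒦 s₀ φ) s h)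
    (P₁ : Finset ℂ) (E₁ : ℂ → HA L e dV hdV dW hdW → ℂ)
    (hd₁ : ∀ h : HA L e dV hdV dW hdW, DifferentiableOn ℂ (fun s => E₁ s h) {s : ℂ | 0 < s.re})
    (hii₁ : ∀ s : ℂ, 0 < s.re → Continuous (E₁ s))
    (hiv₁ : ∀ (s : ℂ) (h : HA L e dV hdV dW hdW), (n : ℝ) / 2 < s.re →
      E₁ s h = (∏ p ∈ P₁, (s - p)) * eisensteinFamilyDelta L e dV hdV dW hdW (stdExtension 𝒦 s₀ Xφ) s h)
    (hv₁ : ∀ z : ℂ, 0 < z.re → ∃ C A r : ℝ, 0 < r ∧ ∀ s : ℂ, dist s z < r → ∀ h : HA L e dV hdV dW hdW,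
      ‖E₁ s h‖ ≤ C * adelicHeightGL (n + n) L (h : GL (Fin (n + n)) (AdeleRing (𝓞 L) L)) ^ A)
    (P₂ : Finset ℂ) (E₂ : ℂ → HA L e dV hdV dW hdW → ℂ)
    (hd₂ : ∀ h : HA L e dV hdV dW hdW, DifferentiableOn ℂ (fun s => E₂ s h) {s : ℂ | 0 < s.re})
    (hii₂ : ∀ s : ℂ, 0 < s.re → Continuous (E₂ s))
    (hiv₂ : ∀ (s : ℂ) (h : HA L e dV hdV dW hdW), (n : ℝ) / 2 < s.re →
      E₂ s h = (∏ p ∈ P₂, (s - p)) * eisensteinFamilyDelta L e dV hdV dW hdW (stdExtension 𝒦 s₀ (fun y => (H y : ℂ) * φ y)) s h)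
    (hv₂ : ∀ z : ℂ, 0 < z.re → ∃ C A r : ℝ, 0 < r ∧ ∀ s : ℂ, dist s z < r → ∀ h : HA L e dV hdV dW hdW,
      ‖E₂ s h‖ ≤ C * adelicHeightGL (n + n) L (h : GL (Fin (n + n)) (AdeleRing (𝓞 L) L)) ^ A)
    (h₀ : HA L e dV hdV dW hdW) (t : ℝ) :
    HasDerivAt
      (fun t : ℝ => resNorm P Es (h₀ * archExp (Fp L) L (IsCMField.complexConj L) (n + n) (hermD L e dV hdV dW hdW) hX t))
      (resNorm P₁ E₁ (h₀ * archExp (Fp L) L (IsCMField.complexConj L) (n + n) (hermD L e dV hdV dW hdW) hX t) +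
        2 * (1 / 2 - s₀) * resNorm P₂ E₂ (h₀ * archExp (Fp L) L (IsCMField.complexConj L) (n + n) (hermD L e dV hdV dW hdW) hX t)) t := by
  -- the three families are continuous section families
  have hK : 𝒦.IsDeltaUnimodular := IwasawaDatum.modDelta_eq_one_of_mem L e dV hdV hdV0 dW hdW hdW0 𝒦
  have hf : ∀ s, IsSiegelDeltaSection L e dV hdV dW hdW χ s (stdExtension 𝒦 s₀ φ s) := fun s =>
    isSiegelDeltaSection_stdExtension hK hφ s
  have hfc : ∀ s, Continuous (stdExtension 𝒦 s₀ φ s) := fun s => continuous_stdExtension L e dV hdV hdV0 dW hdW hdW0 𝒦 s₀ hφc s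
  have hf₁ : ∀ s, IsSiegelDeltaSection L e dV hdV dW hdW χ s (stdExtension 𝒦 s₀ Xφ s) := fun s =>
    isSiegelDeltaSection_stdExtension hK (isSiegelDeltaSection_lieDeriv hX hφ hXφ) s
  have hf₁c : ∀ s, Continuous (stdExtension 𝒦 s₀ Xφ s) := fun s => continuous_stdExtension L e dV hdV hdV0 dW hdW hdW0 𝒦 s₀ hXφc s
  have hf₂ : ∀ s, IsSiegelDeltaSection L e dV hdV dW hdW χ s (stdExtension 𝒦 s₀ (fun y => (H y : ℂ) * φ y) s) := fun s =>
    isSiegelDeltaSection_stdExtension hK (isSiegelDeltaSection_heightDeriv_mul hX hK hφ hH) s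
  have hf₂c : ∀ s, Continuous (stdExtension 𝒦 s₀ (fun y => (H y : ℂ) * φ y) s) := fun s =>
    continuous_stdExtension L e dV hdV hdV0 dW hdW hdW0 𝒦 s₀ ((Complex.continuous_ofReal.comp hHc).mul hφc) s
  -- the coefficient `a(s) = 2(s − s₀)`
  have ha : Differentiable ℂ (fun s : ℂ => 2 * (s - s₀)) := (differentiable_id.sub (differentiable_const _)).const_mul _
  -- the orbit
  have hγc := continuous_archOrbit L e dV hdV dW hdW h₀ hX
  have hγ := exists_height_bounds_archOrbit L e dV hdV dW hdW hn h₀ hX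
  have hn0 : (0 : ℝ) ≤ (n : ℝ) / 2 := by positivity
  -- the inputs of ★ G1 file 3 for `f`, `f′ = f₁ + a·f₂` and the combined package `(P₁ ∪ P₂, E′)`
  have hXd := hX_stdExtension L e dV hdV dW hdW 𝒦 s₀ hX hXφ hH h₀
  have hsum := hsum_of_section L e dV hdV hdV0 dW hdW hdW0 hχ hf hfc
    (h₀ * archExp (Fp L) L (IsCMField.complexConj L) (n + n) (hermD L e dV hdV dW hdW) hX 0)
  have hmaj := hmaj_add_mul L e dV hdV hdV0 dW hdW hdW0 hX hχ (fun s : ℂ => 2 * (s - s₀)) hf₁ hf₁c hf₂ hf₂c h₀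
  have hd' := continuation_add_mul_differentiableOn L e dV hdV dW hdW (P₁ := P₁) (P₂ := P₂) ha hd₁ hd₂
  have hii' := continuation_add_mul_continuous L e dV hdV dW hdW (a := fun s : ℂ => 2 * (s - s₀)) (P₁ := P₁) (P₂ := P₂) hii₁ hii₂
  have hiv' := continuation_add_mul_eq L e dV hdV hdV0 dW hdW hdW0 (a := fun s : ℂ => 2 * (s - s₀)) hχ hf₁ hf₁c hf₂ hf₂c hiv₁ hiv₂
  have hv' := continuation_add_mul_growth L e dV hdV dW hdW (P₁ := P₁) (P₂ := P₂) hn ha.continuous hv₁ hv₂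
  -- ★ G1 file 3
  have key := hasDerivAt_resNorm_orbit_of_termwise L e dV hdV dW hdW (stdExtension 𝒦 s₀ φ)
    (fun s x => stdExtension 𝒦 s₀ Xφ s x + (fun s : ℂ => 2 * (s - s₀)) s * stdExtension 𝒦 s₀ (fun y => (H y : ℂ) * φ y) s x)
    (fun t => h₀ * archExp (Fp L) L (IsCMField.complexConj L) (n + n) (hermD L e dV hdV dW hdW) hX t) hγc hγ
    hXd hn0 hsum hmaj P Es hd hiv (P₁ ∪ P₂)
    (fun s x => (∏ p ∈ P₂ \ P₁, (s - p)) * E₁ s x + (fun s : ℂ => 2 * (s - s₀)) s * (∏ p ∈ P₁ \ P₂, (s - p)) * E₂ s x)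
    hd' hii' (fun s x hs => hiv' s x hs) hv' t
  -- the residue form of the combined package
  have hcomb := congrFun (resNorm_continuation_add_mul L e dV hdV hdV0 dW hdW hdW0 hχ ha hf₁ hf₁c hf₂ hf₂c hd₁ hiv₁ hd₂ hiv₂)
    (h₀ * archExp (Fp L) L (IsCMField.complexConj L) (n + n) (hermD L e dV hdV dW hdW) hX t)
  exact key.congr_deriv hcomb

include hdV0 hdW0 in
/-- **G1-END — THE LIE DERIVATIVE OF THE CANONICAL RESIDUE FORM OF A STANDARD FAMILY.**  `n ≥ 1`, `χ` unitary, `𝒦` an Iwasawa datum, `s₀ ∈ ℂ`,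
`X ∈ 𝔥_∞`; BY VALUE: a continuous section `φ ∈ I(s₀, χ)`, its right Lie derivative `Xφ` along `γ_X` (`hXφ`, continuous), the height log-derivative `H`
(`hH`, continuous), and socket #41's five-clause bundles `hex`, `hex₁`, `hex₂` for `stdExt φ`, `stdExt Xφ`, `stdExt(H·φ)`.  Then for every `h₀` and `t`:
`HasDerivAt (fun t => resGen hex (h₀·γ_X t)) (resGen hex₁ (h₀·γ_X t) + 2(½ − s₀)·resGen hex₂ (h₀·γ_X t)) t` (★ `exists_continuation_resGen`, choice-free).
[cite: MoeglinWaldspurger1995, IV.1.9–IV.1.11] [cite: KudlaRallis1994, §1 Thm. 1.1] [cite: Liu2021, Lem. B.12 pp. 103–104] [cite: Tan1999, §1 p. 166] -/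
theorem hasDerivAt_resGen_stdExtension_orbit (hn : 0 < n) {χ : HeckeCharacter L} (hχ : χ.IsUnitary)
    {φ Xφ : HA L e dV hdV dW hdW → ℂ} {H : HA L e dV hdV dW hdW → ℝ}
    (hφ : IsSiegelDeltaSection L e dV hdV dW hdW χ s₀ φ) (hφc : Continuous φ)
    (hXφ : ∀ h : HA L e dV hdV dW hdW,
      HasDerivAt (fun t : ℝ => φ (h * archExp (Fp L) L (IsCMField.complexConj L) (n + n) (hermD L e dV hdV dW hdW) hX t)) (Xφ h) 0)
    (hXφc : Continuous Xφ)
    (hH : ∀ h : HA L e dV hdV dW hdW,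
      HasDerivAt (fun t : ℝ => modDelta L e dV hdV dW hdW (𝒦.pPart (h * archExp (Fp L) L (IsCMField.complexConj L) (n + n)
        (hermD L e dV hdV dW hdW) hX t))) (modDelta L e dV hdV dW hdW (𝒦.pPart h) * H h) 0)
    (hHc : Continuous H)
    (hex : ∃ (P : Finset ℂ) (Es : ℂ → HA L e dV hdV dW hdW → ℂ),
      (∀ h : HA L e dV hdV dW hdW, DifferentiableOn ℂ (fun s => Es s h) {s : ℂ | 0 < s.re}) ∧
      (∀ s : ℂ, 0 < s.re → Continuous (Es s)) ∧
      (∀ s : ℂ, 0 < s.re → ∀ (γ : ratH L e dV hdV dW hdW) (h : HA L e dV hdV dW hdW),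
        Es s ((γ : HA L e dV hdV dW hdW) * h) = Es s h) ∧
      (∀ (s : ℂ) (h : HA L e dV hdV dW hdW), (n : ℝ) / 2 < s.re →
        Es s h = (∏ p ∈ P, (s - p)) * eisensteinFamilyDelta L e dV hdV dW hdW (stdExtension 𝒦 s₀ φ) s h) ∧
      (∀ z : ℂ, 0 < z.re → ∃ C A r : ℝ, 0 < r ∧ ∀ s : ℂ, dist s z < r → ∀ h : HA L e dV hdV dW hdW,
        ‖Es s h‖ ≤ C * adelicHeightGL (n + n) L (h : GL (Fin (n + n)) (AdeleRing (𝓞 L) L)) ^ A))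
    (hex₁ : ∃ (P : Finset ℂ) (Es : ℂ → HA L e dV hdV dW hdW → ℂ),
      (∀ h : HA L e dV hdV dW hdW, DifferentiableOn ℂ (fun s => Es s h) {s : ℂ | 0 < s.re}) ∧
      (∀ s : ℂ, 0 < s.re → Continuous (Es s)) ∧
      (∀ s : ℂ, 0 < s.re → ∀ (γ : ratH L e dV hdV dW hdW) (h : HA L e dV hdV dW hdW),
        Es s ((γ : HA L e dV hdV dW hdW) * h) = Es s h) ∧
      (∀ (s : ℂ) (h : HA L e dV hdV dW hdW), (n : ℝ) / 2 < s.re →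
        Es s h = (∏ p ∈ P, (s - p)) * eisensteinFamilyDelta L e dV hdV dW hdW (stdExtension 𝒦 s₀ Xφ) s h) ∧
      (∀ z : ℂ, 0 < z.re → ∃ C A r : ℝ, 0 < r ∧ ∀ s : ℂ, dist s z < r → ∀ h : HA L e dV hdV dW hdW,
        ‖Es s h‖ ≤ C * adelicHeightGL (n + n) L (h : GL (Fin (n + n)) (AdeleRing (𝓞 L) L)) ^ A))
    (hex₂ : ∃ (P : Finset ℂ) (Es : ℂ → HA L e dV hdV dW hdW → ℂ),
      (∀ h : HA L e dV hdV dW hdW, DifferentiableOn ℂ (fun s => Es s h) {s : ℂ | 0 < s.re}) ∧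
      (∀ s : ℂ, 0 < s.re → Continuous (Es s)) ∧
      (∀ s : ℂ, 0 < s.re → ∀ (γ : ratH L e dV hdV dW hdW) (h : HA L e dV hdV dW hdW),
        Es s ((γ : HA L e dV hdV dW hdW) * h) = Es s h) ∧
      (∀ (s : ℂ) (h : HA L e dV hdV dW hdW), (n : ℝ) / 2 < s.re →
        Es s h = (∏ p ∈ P, (s - p)) *
          eisensteinFamilyDelta L e dV hdV dW hdW (stdExtension 𝒦 s₀ (fun y => (H y : ℂ) * φ y)) s h) ∧
      (∀ z : ℂ, 0 < z.re → ∃ C A r : ℝ, 0 < r ∧ ∀ s : ℂ, dist s z < r → ∀ h : HA L e dV hdV dW hdW,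
        ‖Es s h‖ ≤ C * adelicHeightGL (n + n) L (h : GL (Fin (n + n)) (AdeleRing (𝓞 L) L)) ^ A))
    (h₀ : HA L e dV hdV dW hdW) (t : ℝ) :
    HasDerivAt
      (fun t : ℝ => resGen hex (h₀ * archExp (Fp L) L (IsCMField.complexConj L) (n + n) (hermD L e dV hdV dW hdW) hX t))
      (resGen hex₁ (h₀ * archExp (Fp L) L (IsCMField.complexConj L) (n + n) (hermD L e dV hdV dW hdW) hX t) +
        2 * (1 / 2 - s₀) * resGen hex₂ (h₀ * archExp (Fp L) L (IsCMField.complexConj L) (n + n) (hermD L e dV hdV dW hdW) hX t)) t := by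
  -- the three packages (choice-free, ★ U0.2)
  obtain ⟨P, Es, ⟨hd, -, -, hiv, -⟩, hres⟩ := exists_continuation_resGen hex
  obtain ⟨P₁, E₁, ⟨hd₁, hii₁, -, hiv₁, hv₁⟩, hres₁⟩ := exists_continuation_resGen hex₁
  obtain ⟨P₂, E₂, ⟨hd₂, hii₂, -, hiv₂, hv₂⟩, hres₂⟩ := exists_continuation_resGen hex₂
  rw [hres, hres₁, hres₂]
  exact hasDerivAt_resNorm_stdExtension_orbit L e dV hdV hdV0 dW hdW hdW0 𝒦 s₀ hX hn hχ hφ hφc hXφ hXφc hH hHc P Es hd hiv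
    P₁ E₁ hd₁ hii₁ hiv₁ hv₁ P₂ E₂ hd₂ hii₂ hiv₂ hv₂ h₀ t

include hdV0 hdW0 in
/-- **G1-END AT THE CENTRE `s₀ = ½`**: the height-derivative family enters `f′` with the factor `2(s − ½)`, whose residue form VANISHES EXACTLY, so
`HasDerivAt (fun t => resGen hex (h₀·γ_X t)) (resGen hex₁ (h₀·γ_X t)) t` — the residue form of `stdExt_{½}(φ)` differentiates along `γ_X` into the residue
form of `stdExt_{½}(X·φ)` («`X·Res(φ) = Res(X·φ)`», the `𝔤_∞`-equivariance of the first-term residue consumed by Hol-1 and U5).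
[cite: KudlaRallis1994, §1 Thm. 1.1] [cite: MoeglinWaldspurger1995, IV.1.9–IV.1.11] [cite: Liu2021, Lem. B.12 pp. 103–104] -/
theorem hasDerivAt_resGen_stdExtension_orbit_half (hn : 0 < n) {χ : HeckeCharacter L} (hχ : χ.IsUnitary)
    {φ Xφ : HA L e dV hdV dW hdW → ℂ} {H : HA L e dV hdV dW hdW → ℝ}
    (hφ : IsSiegelDeltaSection L e dV hdV dW hdW χ (1 / 2) φ) (hφc : Continuous φ)
    (hXφ : ∀ h : HA L e dV hdV dW hdW,
      HasDerivAt (fun t : ℝ => φ (h * archExp (Fp L) L (IsCMField.complexConj L) (n + n) (hermD L e dV hdV dW hdW) hX t)) (Xφ h) 0)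
    (hXφc : Continuous Xφ)
    (hH : ∀ h : HA L e dV hdV dW hdW,
      HasDerivAt (fun t : ℝ => modDelta L e dV hdV dW hdW (𝒦.pPart (h * archExp (Fp L) L (IsCMField.complexConj L) (n + n)
        (hermD L e dV hdV dW hdW) hX t))) (modDelta L e dV hdV dW hdW (𝒦.pPart h) * H h) 0)
    (hHc : Continuous H)
    (hex : ∃ (P : Finset ℂ) (Es : ℂ → HA L e dV hdV dW hdW → ℂ),
      (∀ h : HA L e dV hdV dW hdW, DifferentiableOn ℂ (fun s => Es s h) {s : ℂ | 0 < s.re}) ∧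
      (∀ s : ℂ, 0 < s.re → Continuous (Es s)) ∧
      (∀ s : ℂ, 0 < s.re → ∀ (γ : ratH L e dV hdV dW hdW) (h : HA L e dV hdV dW hdW),
        Es s ((γ : HA L e dV hdV dW hdW) * h) = Es s h) ∧
      (∀ (s : ℂ) (h : HA L e dV hdV dW hdW), (n : ℝ) / 2 < s.re →
        Es s h = (∏ p ∈ P, (s - p)) * eisensteinFamilyDelta L e dV hdV dW hdW (stdExtension 𝒦 (1 / 2) φ) s h) ∧
      (∀ z : ℂ, 0 < z.re → ∃ C A r : ℝ, 0 < r ∧ ∀ s : ℂ, dist s z < r → ∀ h : HA L e dV hdV dW hdW,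
        ‖Es s h‖ ≤ C * adelicHeightGL (n + n) L (h : GL (Fin (n + n)) (AdeleRing (𝓞 L) L)) ^ A))
    (hex₁ : ∃ (P : Finset ℂ) (Es : ℂ → HA L e dV hdV dW hdW → ℂ),
      (∀ h : HA L e dV hdV dW hdW, DifferentiableOn ℂ (fun s => Es s h) {s : ℂ | 0 < s.re}) ∧
      (∀ s : ℂ, 0 < s.re → Continuous (Es s)) ∧
      (∀ s : ℂ, 0 < s.re → ∀ (γ : ratH L e dV hdV dW hdW) (h : HA L e dV hdV dW hdW),
        Es s ((γ : HA L e dV hdV dW hdW) * h) = Es s h) ∧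
      (∀ (s : ℂ) (h : HA L e dV hdV dW hdW), (n : ℝ) / 2 < s.re →
        Es s h = (∏ p ∈ P, (s - p)) * eisensteinFamilyDelta L e dV hdV dW hdW (stdExtension 𝒦 (1 / 2) Xφ) s h) ∧
      (∀ z : ℂ, 0 < z.re → ∃ C A r : ℝ, 0 < r ∧ ∀ s : ℂ, dist s z < r → ∀ h : HA L e dV hdV dW hdW,
        ‖Es s h‖ ≤ C * adelicHeightGL (n + n) L (h : GL (Fin (n + n)) (AdeleRing (𝓞 L) L)) ^ A))
    (hex₂ : ∃ (P : Finset ℂ) (Es : ℂ → HA L e dV hdV dW hdW → ℂ),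
      (∀ h : HA L e dV hdV dW hdW, DifferentiableOn ℂ (fun s => Es s h) {s : ℂ | 0 < s.re}) ∧
      (∀ s : ℂ, 0 < s.re → Continuous (Es s)) ∧
      (∀ s : ℂ, 0 < s.re → ∀ (γ : ratH L e dV hdV dW hdW) (h : HA L e dV hdV dW hdW),
        Es s ((γ : HA L e dV hdV dW hdW) * h) = Es s h) ∧
      (∀ (s : ℂ) (h : HA L e dV hdV dW hdW), (n : ℝ) / 2 < s.re →
        Es s h = (∏ p ∈ P, (s - p)) *
          eisensteinFamilyDelta L e dV hdV dW hdW (stdExtension 𝒦 (1 / 2) (fun y => (H y : ℂ) * φ y)) s h) ∧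
      (∀ z : ℂ, 0 < z.re → ∃ C A r : ℝ, 0 < r ∧ ∀ s : ℂ, dist s z < r → ∀ h : HA L e dV hdV dW hdW,
        ‖Es s h‖ ≤ C * adelicHeightGL (n + n) L (h : GL (Fin (n + n)) (AdeleRing (𝓞 L) L)) ^ A))
    (h₀ : HA L e dV hdV dW hdW) (t : ℝ) :
    HasDerivAt
      (fun t : ℝ => resGen hex (h₀ * archExp (Fp L) L (IsCMField.complexConj L) (n + n) (hermD L e dV hdV dW hdW) hX t))
      (resGen hex₁ (h₀ * archExp (Fp L) L (IsCMField.complexConj L) (n + n) (hermD L e dV hdV dW hdW) hX t)) t := by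
  have key := hasDerivAt_resGen_stdExtension_orbit L e dV hdV hdV0 dW hdW hdW0 𝒦 (1 / 2) hX hn hχ hφ hφc hXφ hXφc hH hHc hex hex₁ hex₂ h₀ t
  simpa only [sub_self, mul_zero, zero_mul, add_zero] using key

end End

end Frame

end Summit.HodgeConjecture.HodgeConjecture.Cruxes.HLiu418.K2LiuResidueLieDerivativeStandard

end
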